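import Summits.CriticalPhenomena.PercolationContinuityZ3.Theorems.PercNearOneGluingNoHeavyConstsPinnedBinding
import Summits.CriticalPhenomena.PercolationContinuityZ3.Theorems.PercNearOneGluingNoHeavyConstsCrossReachMarkerPinnedEdgeExchanges
import HarnessLib

/-!
# (P_pin) ⟹ the u = z CROSS member for every monotone 0/1 functional (assembly)
# (PAPER-2 track (ii): constants of the CSH family; seat `prim-consts-2`, gen 24 assembly)

builds on p205010 (kernel theorem, internal audit signed; external expert review pending).  Support file (`--supports
stmt-CriticalPhenomena-4575`).  Combines `Consts.crossM2_of_pinnedBinding` (…ConstsPinnedBinding.lean) with the pinned class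
`Consts.crossRel_edge_M2_of_markerPinned` (…ConstsCrossReachMarkerPinnedEdgeExchanges.lean): under the conjecture `Consts.PinnedBinding`,
`M₂(X)(F) ≥ 0` for every weighted graph, all `s, y, z, X` and every monotone 0/1-valued functional `F` of the open edge cluster.
[cite: VandenbergHaggstromKahn2005, Thm. 1.1 and its proof (pp. 3–5), Thm. 1.3 (p. 6)]
-/

noncomputable section

namespace Summit.CriticalPhenomena.PercolationContinuityZ3.Theorems

open MeasureTheory Set Literature.Probability.LatticeModels Literature.Probability.Percolation
open scoped Classical

namespace Consts

/-- **(P_pin) ⟹ the u = z CROSS member `M₂(X)(F) ≥ 0` for every monotone 0/1 functional** (conditional on `Consts.PinnedBinding`).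
[cite: VandenbergHaggstromKahn2005, Thm. 1.1 (pp. 3–5)] -/
theorem crossM2_all_of_pinnedBinding (hPB : PinnedBinding) {n : ℕ} (w : Sym2 (Fin n) → unitInterval) (s y z : Fin n) (X : Set (Fin n))
    (F : Set (Sym2 (Fin n)) → ℝ) (hFm : Monotone F) (hF01 : ∀ C, F C = 0 ∨ F C = 1) :
    0 ≤ polMargin (prodBernoulli w) s y z F (insert z X) (insert z X) X +
          polMargin (prodBernoulli w) s y z F (insert z X) X (insert z X) +
        polMargin (prodBernoulli w) s y z F X (insert z X) (insert z X) :=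
  crossM2_of_pinnedBinding hPB w s y z X (fun G hGm hG01 hGY => crossRel_edge_M2_of_markerPinned w s y z X G hGm hG01 hGY) F hFm hF01

end Consts

end Summit.CriticalPhenomena.PercolationContinuityZ3.Theorems

end
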